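/-
Copyright (c) 2026 the pub-hodgecm-mathlib formalisation cell (harness21).  Prover seat hodgecm-mathlib-K2E3-p32 (g4) (E3 hand on strike line L1; F-chain integrator of the
U1-glob TOP, RULING «M-160j» road (R-eq), LEAD F0P6-plan (g16) BATCH #280), Track B «K2-LIT» ∕ hLiu418 = `stmt-HodgeConjecture-24832`: THE M-160j GENERATION LETTER —
★ p864053 (F4-END, K2Liu-p27 (g3)) `K2LiuFaceGGeneratorsInDomainOfRecord.hGgen_of_record` RE-HEADED WITHOUT ITS VESTIGIAL ISOTROPY BINDERS (proof = ★'s, verbatim).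
THEOREMS ONLY (no `def`, no `instance`, no notation, no named-fact hypothesis, no `sorry`); lane `--supports stmt-HodgeConjecture-24832 --as helper` (count-neutral).
-/
import Summits.HodgeConjecture.HodgeConjecture.Theorems.K2LiuArchSWDataInductionDirected   -- (b) (this seat): `good_tupleVec_directed_at_junctionFrames` (★ 2a∕2b DIRECTED at the junction frames; (piv) ★ p863733, (DX±) ★ p863764, (dom)(vac) ★ p863506)
import Summits.HodgeConjecture.HodgeConjecture.Theorems.K2LiuArchSWDataFinalPassage       -- ★ B3-b FILE 3 (K2E3-p23): `forall_domain_good_of_archGenerators`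
import Summits.HodgeConjecture.HodgeConjecture.Theorems.K2LiuArchSWDataPartnerOfIsStd     -- ★ p863836 (K2Liu-p23): `hpartner_of_isStd` (∘ ★ p863778 LH7-p05 `partner_letter_of_isStd` ∘ ★ (E-g-glue))
import Summits.HodgeConjecture.HodgeConjecture.Theorems.K2LiuArchPlaceSecFockDegree       -- ★ (K2Liu-p27 g0): `isArchDatum_hermiteSpan_of_closure_kV` (σ15 with the bare closure letter `hK₀`)
import Summits.HodgeConjecture.HodgeConjecture.Theorems.K2LiuArchDoubledSignFrameTwo      -- ★ `exists_signFrame_two`, `eq_two_of_frame`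
import Summits.HodgeConjecture.HodgeConjecture.Theorems.K2LiuArchGaussianOfRecord         -- ★ (LH7-p05): `holCutOfRecord` (the hol cut OF RECORD, `HL_rec`)
import Literature.NumberTheory.GelbartRogawski1991.CMSplittingCharArchComponents          -- ★ `IsSplittingChar.exists_hasUnitaryArchType_odd`
import HarnessLib

/-!
# Crux `HLiu418`, U1-glob TOP (#42F′ `slot_vanRes2E`), road (R-eq) of RULING «M-160j»: THE INDUCTION PRINCIPLE ON ADMISSIBLE DATA FOR EVERY SIGNATURE —
# ★ F4-END `hGgen_of_record` without the isotropic-branch binders `(a′) (T) (hT) (hdisc)`, which its proof never uses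

Cell `hodgecm-mathlib`, crux item hLiu418 = `stmt-HodgeConjecture-24832`; squad K2, strike line L1, LEAD F0P6-plan (g16); TOP ★ p864881 (K2E3-p23 (g9)); F2 ★ p864850 ∕ ★ p865003 ∕
★ p864914; F3-glob-1 ★ p865029 (K2E3-p32 (g4)); (R-eq) assembler K2E3-p14 (g10); hole census LH7-p08 (g3); author of ★ F4-END K2Liu-p27 (g3).

THE POINT (K2E3-p32 (g4) finding 2026-09-05).  RULING M-160j booked ONE named hole for `slot_vanRes2E` at general `K_∞`-type: a GENERATION letter «the dead data form a
`(𝔤_∞, K_∞)`-submodule containing every `K_∞`-finite datum».  The tree already holds it as ★ F4-END `hGgen_of_record` — FACE-G's L3 «(G-gen) THE INDUCTION PRINCIPLE ON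
ADMISSIBLE DATA»: for a STANDARD `𝒦` (with the three standing letters `hDX hK₀ hread` of organ F4, ★ payers of record) and EVERY property `Good V x` of admissible data
(`V` finite-dimensional `IsArchStable`, `x ∈ D_V`) which holds on the hol-cut domains of record (the Gaussian line, (base)), reads `x` only through its twisted Siegel–Weil
generator family (congr), is closed under (zero)(add)(smul) and under archimedean Lie-derivative steps of the `s₀`-sections (deriv) — `Good` holds on EVERY `D_V`.  Its ★
statement carries the ISOTROPIC-branch binders `∀ (a′) (T), ‹T is an adelic Witt frame of V′› → ‹−a′ is represented› →` because the F1-directed slot it pays does; ITS PROOF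
NEVER USES THEM (★ :201 `intro a' T hT hdisc …`, the names occur below only as fresh shadowing binders): the construction runs over the sign blocks `PosIdx ∕ NegIdx` of
`σ(dV′)` at EVERY real place — definite places included — through ★ `blockFFT ∕ blockFFT_swap`, ★ `fock_induction_of_blockFFT_of_pivot` (vacuum, `𝔭^±` steps as arch Lie
derivatives, see-saw pivot), ★ `exists_junctionFrameData_embedding`, ★ σ15 Hermite data.  THIS FILE states the principle WITHOUT those binders (everything else byte-identical
to ★ `hGgen`'s body) and proves it by ★ F4-END's proof VERBATIM.  For the (R-eq) assembler: `Good V x := ∀ hex : ‹#41 bundle of genFamily x›, resGen hex = 0` — (base) the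
scalar-type hol-cut surface (by value; the (σ-A) road), (congr) ★ `resGen_family_congr`, (zero)(add)(smul) ★ `resGen_finset_sum`, (deriv) ★ F3-glob-1∕-3 — and the
M-160j hole COLLAPSES to the standing letters `hK₀ hread` at the tie's datum (★ payers on the adapted arch class, as for #42F′'s FACE-G).
* **`hGgen_allSignatures (DX) (L … 𝒦 h𝒦) (hDX) (hK₀) (hread) : ∀ Good, (base) → (congr) → (zero) → (add) → (smul) → (deriv) → ∀ V, FiniteDimensional ℂ V → IsArchStable … V → ∀ x, Good V x`.**
References: [Howe1989] R. Howe, Trans. AMS 313 (1989) §3; [KudlaRallis1994] S. Kudla, S. Rallis, Ann. of Math. 140 (1994) §1 Thm. 1.1, §3; [Folland1989] G. B. Folland,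
Harmonic Analysis in Phase Space, §1.7 (1.81), §4.2 Prop. (4.39); [MoeglinWaldspurger1995] IV.1.9–11; [Liu2021] Y. Liu, Camb. J. Math. 9 (2021) Remark 4.2, App. B
Lem. B.9–B.12, proof of Prop. B.8 pp. 103–106.
HONEST LABEL.  Count-neutral helper; `HC_CM` is proved only modulo the 7 printed citations (2 remaining named inputs: hLiu418 = `stmt-HodgeConjecture-24832`,
h413 = `stmt-HodgeConjecture-24833`) until rung 0 closes; `slot_vanRes2E` stays OPEN until the assembler + base letters + `hK₀ hread` at the tie's datum are ★.
-/

set_option autoImplicit false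
set_option linter.dupNamespace false -- the mandated namespace repeats `HodgeConjecture.HodgeConjecture`

noncomputable section

open scoped Classical Matrix MatrixGroups TensorProduct Kronecker SchwartzMap Real
open MvPolynomial Complex
open NumberField NumberField.InfinitePlace NumberField.mixedEmbedding IsDedekindDomain
open Literature.Analysis.SegalBargmann Literature.RepresentationTheory.HeisenbergGroup
open Literature.NumberTheory.Automorphic Literature.NumberTheory.Automorphic.UnitaryGroup Literature.NumberTheory.GaloisRepresentations
open Literature.NumberTheory.Weil1964 Literature.NumberTheory.Weil1964.MpS Literature.NumberTheory.Weil1964.UnitaryWeil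
open Literature.RepresentationTheory.HarrisKudlaSweet1996
open Literature.RepresentationTheory.KonnoKonno2007 hiding LetterKind letterOf letterGen letterOf_boost letterOf_torus letterOf_torus_eq
  letterGen_boost letterGen_torus letterGen_mem_lie exp_smul_letterGen
open Literature.RepresentationTheory.KonnoKonno2007.RealDualPair
open Literature.RepresentationTheory.KonnoKonno2007.RealDualPair.UForm
open Literature.NumberTheory.GelbartRogawski1991 Literature.NumberTheory.GelbartRogawski1991.GRConstruction
open Literature.NumberTheory.GelbartRogawski1991.UnitaryDualPair
open Literature.NumberTheory.GelbartRogawski1991.UnitaryDualPair.LocalSplitting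
open Literature.NumberTheory.K2Lit.SiegelDoubled
open Literature.NumberTheory.Automorphic.IdeleClassGroup
open Literature.NumberTheory.Automorphic.Liu2021
open Literature.NumberTheory.Automorphic.Liu2021.Def411WeilCarriers
open Literature.NumberTheory.Automorphic.Liu2021.Def411WeilCarriersDoubling
open Literature.RepresentationTheory.Liu2021
open Summit.HodgeConjecture.HodgeConjecture.Cruxes.HLiu418.K2LiuArchSectionPlaceBlock
open Summit.HodgeConjecture.HodgeConjecture.Cruxes.HLiu418 (K2LiuArchOneParameterOrbitDefs.archEmb K2LiuArchOneParameterOrbitDefs.archExp)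
open Summit.HodgeConjecture.HodgeConjecture.Cruxes.HLiu418.K2LiuFaceGLetterDefs (IsArchStable genFamily HasArchDeriv)
open Summit.HodgeConjecture.HodgeConjecture.Cruxes.HLiu418.K2LiuArchSWDataTuplesDefs
open Summit.HodgeConjecture.HodgeConjecture.Cruxes.HLiu418.K2LiuArchSWSpanningDefs (IsArchDatum)
open Summit.HodgeConjecture.HodgeConjecture.Cruxes.HLiu418.K2LiuArchDoubledSignFrameTwo (exists_signFrame_two eq_two_of_frame)

namespace Summit.HodgeConjecture.HodgeConjecture.Cruxes.HLiu418.K2LiuArchWeilSectionModuleCyclic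

/-- **THE INDUCTION PRINCIPLE ON ADMISSIBLE DATA, EVERY SIGNATURE** — ★ F4-END `hGgen_of_record`'s statement with the isotropic-branch binders `(a′) (T) (hT) (hdisc)` REMOVED
(its proof never used them), proof = ★'s verbatim: for a standard datum `𝒦` carrying organ F4's standing letters `hDX` (the direction family sees the chart-image directions;
trivial at `DX := ⊤`), `hK₀` (the arch part of `𝒦.K` is generated by the one-place sign-frame compacts; ★ `hK₀_of_archClass` on the adapted arch class) and `hread` (the arch-leg
reading of the compact operators), every property `Good` of admissible data with (base) on the hol-cut domains of record, (congr), (zero)(add)(smul), (deriv) along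
`DX`-directions holds on every finite-dimensional arch-stable rigidity domain.  [cite: Howe1989, §3] [cite: KudlaRallis1994, §1 Thm. 1.1, §3]
[cite: Folland1989, §1.7 (1.81), §4.2 Prop. (4.39)] [cite: Liu2021, App. B proof of Prop. B.8 pp. 103–106] -/
theorem hGgen_allSignatures
    (DX : ∀ (L : Type) [Field L] [NumberField L] [IsCMField L] {n : ℕ} (e : Fin 2 × Fin 1 ≃ Fin n)
      (dV : Fin 2 → L) (_hdV : ∀ i, IsCMField.complexConj L (dV i) = dV i)
      (dW : Fin 1 → L) (_hdW : ∀ i, IsCMField.complexConj L (dW i) = dW i), Matrix (Fin (n + n)) (Fin (n + n)) (mixedSpace L) → Prop)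
    (L : Type) [Field L] [NumberField L] [IsCMField L] {n : ℕ} (e : Fin 2 × Fin 1 ≃ Fin n)
      (dV : Fin 2 → L) (hdV : ∀ i, IsCMField.complexConj L (dV i) = dV i) (hdV0 : ∀ i, dV i ≠ 0)
      (dW : Fin 1 → L) (hdW : ∀ i, IsCMField.complexConj L (dW i) = dW i) (hdW0 : ∀ i, dW i ≠ 0)
      (lam : Literature.NumberTheory.Automorphic.IdeleClassGroup L →ₜ* Circle) (hlam : IsConjugateSymplectic L lam)
      (_hwt : HasWeight L lam 1)
      {M' n' : ℕ} (eW : Fin 1 × Fin 3 ≃ Fin M') (e' : Fin 2 × Fin M' ≃ Fin n')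
        (dV' : Fin 3 → L) (hdV' : ∀ k, IsCMField.complexConj L (dV' k) = dV' k) (hdV'0 : ∀ k, dV' k ≠ 0)
        (χb : HeckeCharacter L) (hχbu : χb.IsUnitary) (hχbs : Literature.RepresentationTheory.HarrisKudlaSweet1996.IsSplittingChar L 1 χb)
        (α : UnitaryGroup.adelicOne (Fp L) L (IsCMField.complexConj L) →* ℂˣ) (hα : Continuous α)
        (hαrat : ∀ u : UnitaryGroup.adelicOne (Fp L) L (IsCMField.complexConj L),
          (u : Literature.NumberTheory.GaloisRepresentations.ideleGroup L) ∈ Literature.NumberTheory.GaloisRepresentations.principalIdeles L → α u = 1)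
        (_hχD : χb ^ 3 * DoubledWeilDetTwist.ratioHecke L α hα hαrat = toHeckeCharacter L lam⁻¹)
        (𝒦 : IwasawaDatum L e dV hdV dW hdW) (h𝒦 : 𝒦.IsStd)
    -- (F4's letter 1) THE DIRECTION FAMILY SEES THE CHART IMAGES: every `X ∈ archSkew` with the one-place curve `archExp hX s = archEmb (placeSecJ_𝔻 σ e₂P e₂Q (exp sY, 1))`
    -- and supported over `σ` (★ `exists_archSkew_archExp_eq_placeSecJ_expMem`'s TWO conjuncts, bytes verbatim; frames universal) is a `DX`-direction — at the SINGLE-PLACE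
    -- `DX` of record (F1 desk 2026-09-05T00:23:21Z) `fun σ e₂P e₂Q Y X hX _ hw => ⟨cmPlaceOver L σ, hw⟩`; at `DX′` `fun … h _ => ⟨hX, hdV0, hdW0, σ, e₂P, e₂Q, Y, h⟩`; at `⊤` trivial
    (hDX : letI : LieRing (Matrix (Fin 2 ⊕ Fin 2) (Fin 2 ⊕ Fin 2) ℂ) := LieRing.ofAssociativeRing
      ∀ (σ : {v : InfinitePlace (Fp L) // v.IsReal})
      (e₂P : PosIdx (signVec (cmPlaceOver L)
        (fun k => Sum.elim (cmGramEntry L e dV hdV dW hdW) (-cmGramEntry L e dV hdV dW hdW) ((LocalSplitting.e₂ n).symm k)) (imagUnit L) σ) ≃ Fin 2)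
      (e₂Q : NegIdx (signVec (cmPlaceOver L)
        (fun k => Sum.elim (cmGramEntry L e dV hdV dW hdW) (-cmGramEntry L e dV hdV dW hdW) ((LocalSplitting.e₂ n).symm k)) (imagUnit L) σ) ≃ Fin 2)
      (Y : ↥(uFormGroup (Fin 2) (Fin 2)).lie.toSubmodule)
      (X : Matrix (Fin (n + n)) (Fin (n + n)) (mixedSpace L)) (hX : X ∈ archSkew (Fp L) L (IsCMField.complexConj L) (n + n) (hermD L e dV hdV dW hdW)),
      (∀ s : ℝ, K2LiuArchOneParameterOrbitDefs.archExp (Fp L) L (IsCMField.complexConj L) (n + n) (hermD L e dV hdV dW hdW) hX s =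
        K2LiuArchOneParameterOrbitDefs.archEmb (Fp L) L (IsCMField.complexConj L) (n + n) (hermD L e dV hdV dW hdW)
          (placeSecJ L (IsCMField.complexConj L) (n + n) (IsCMField.complexConj_ne_one L) (cmPlaceOver L) (cmPlaceOver_smul L) _
            (gramD_gram_realDiagonal_entry_ne_zero L e dV hdV dW hdW hdV0 hdW0) (complexConj_imagUnit L) (imagUnit_ne_zero L) σ
            (cmPlaceOver_comap L) (gramD_eq_diagonal_cm L e dV hdV dW hdW) (J := hermD L e dV hdV dW hdW) rfl
            (complexConj_smul_infinitePlace L) e₂P e₂Q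
            ((((uFormGroup (Fin 2) (Fin 2)).expMem
                ⟨((s • Y : ↥(uFormGroup (Fin 2) (Fin 2)).lie.toSubmodule) : Matrix (Fin 2 ⊕ Fin 2) (Fin 2 ⊕ Fin 2) ℂ), (s • Y).2⟩ :
                UForm (Fin 2) (Fin 2)), (1 : UForm Unit Empty)) : Ginf (Fin 2) (Fin 2) Unit Empty))) →
      (∀ w : {w : InfinitePlace L // w.IsComplex}, w ≠ cmPlaceOver L σ → X.map (evalC L w) = 0) →
      DX L e dV hdV dW hdW X)
    -- (F4's letter 2) THE STANDING CLOSURE LETTER `hK₀` (★ `isArchDatum_hermiteSpan_of_closure_kV`'s binder, bytes verbatim): the arch part of `𝒦.K` lies in the submonoid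
    -- generated by the one-place sign-frame compacts — OWED at the arch class of the sign-frame-adapted datum only (M-160c (i); payer K2E3-p31 `hK₀_of_archClass`)
    (hK₀ : ∀ ainf : UnitaryGroup.arch (Fp L) L (IsCMField.complexConj L) (n + n) (hermD L e dV hdV dW hdW),
      (UnitaryGroup.archToAdelic (Fp L) L (IsCMField.complexConj L) (n + n) (hermD L e dV hdV dW hdW) ainf : HA L e dV hdV dW hdW) ∈ 𝒦.K →
      ainf ∈ Submonoid.closure {k : UnitaryGroup.arch (Fp L) L (IsCMField.complexConj L) (n + n) (hermD L e dV hdV dW hdW) |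
        ∃ (σ : {v : InfinitePlace (Fp L) // v.IsReal}) (k₁ : Matrix.unitaryGroup (PosIdx (signVec (cmPlaceOver L) (fun k => Sum.elim (cmGramEntry L e dV hdV dW hdW) (-cmGramEntry L e dV hdV dW hdW) ((LocalSplitting.e₂ n).symm k)) (imagUnit L) σ)) ℂ × Matrix.unitaryGroup (NegIdx (signVec (cmPlaceOver L) (fun k => Sum.elim (cmGramEntry L e dV hdV dW hdW) (-cmGramEntry L e dV hdV dW hdW) ((LocalSplitting.e₂ n).symm k)) (imagUnit L) σ)) ℂ),
          k = (placeSec L (IsCMField.complexConj L) (n + n) (IsCMField.complexConj_ne_one L) (cmPlaceOver L) (cmPlaceOver_smul L) _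
          (gramD_gram_realDiagonal_entry_ne_zero L e dV hdV dW hdW hdV0 hdW0) (complexConj_imagUnit L) (imagUnit_ne_zero L) σ
          (cmPlaceOver_comap L) (gramD_eq_diagonal_cm L e dV hdV dW hdW) (J := hermD L e dV hdV dW hdW) rfl
          (complexConj_smul_infinitePlace L) (UForm.kV _ _ k₁))})
    -- (F4's letter 3) THE ARCH-LEG READING `hread` OF THE COMPACT OPERATORS (★ K2Liu-p23 `K2LiuArchSWDataPartnerOfIsStd.hpartner_of_isStd`'s binder, bytes verbatim): every
    -- `ω(sB(k ⊗ 1))`, `k ∈ 𝒦.K`, reads on pure tensors as `c • (framed unitary conjugation ⊗ finite-slot map)` — payers ★ p863778 LH7-p05 `hread_of_frameUnitary` ∘ K2E3-p25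
    -- (S1-brick) `hKU_of_hK₀` (from `hK₀`, `ht hodd`); it feeds the (E-g) polynomial partner (★ p863778 `partner_letter_of_isStd`, ★ p863527, ★ (β) p863624)
    (hread : ∀ k ∈ 𝒦.K, ∃ (x : MpS (Fin (n' + n') × {v : InfinitePlace (Fp L) // v.IsReal}))
      (u : Matrix.unitaryGroup (Fin (n' + n') × {v : InfinitePlace (Fp L) // v.IsReal}) ℂ) (c : ℂ)
      (B : FinSB (Fp L) (Fin (n' + n')) →ₗ[ℂ] FinSB (Fp L) (Fin (n' + n'))),
      MpS.proj x = realifySp (Fin (n' + n') × {v : InfinitePlace (Fp L) // v.IsReal}) u ∧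
      ∀ (a : 𝓢(((Fin (n' + n')) → mixedSpace (Fp L)), ℂ)) (φ : FinSB (Fp L) (Fin (n' + n'))),
        adelicMpCont.omega (Fp L) (Fin (n' + n')) (gramDA L e' dV hdV (tensorFrame L dW eW dV') (tensorFrame_real L dW hdW eW dV' hdV'))
            ((doubledWeilRep L e' dV hdV hdV0 (tensorFrame L dW eW dV') (tensorFrame_real L dW hdW eW dV' hdV')
                  (tensorFrame_ne_zero L dW eW dV' hdW0 hdV'0) χb hχbu hχbs) (tensorEmb L e dV hdV dW hdW eW e' dV' hdV' k))
            (piSchwartzBruhatEquiv (Fp L) (Fin (n' + n')) (a ⊗ₜ[ℂ] φ)) =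
          c • piSchwartzBruhatEquiv (Fp L) (Fin (n' + n'))
            (carrierConjEquiv (frameD L e' dV hdV hdV0 (tensorFrame L dW eW dV') (tensorFrame_real L dW hdW eW dV' hdV')
                (tensorFrame_ne_zero L dW eW dV' hdW0 hdV'0)) x.1.2 a ⊗ₜ[ℂ] B φ)) :
      ∀ (Good : (V : Submodule ℂ 𝓢(((Fin (n' + n')) → mixedSpace (Fp L)), ℂ)) → ↥(Submodule.span ℂ {x : piSchwartzBruhat (Fp L) (Fin (n' + n')) |
              ∃ a ∈ V, ∃ f : FinSB (Fp L) (Fin (n' + n')), x = piSchwartzBruhatEquiv (Fp L) (Fin (n' + n')) (a ⊗ₜ[ℂ] f)}) → Prop),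
        -- (base) the hol-cut domains
        (∀ (V₀ : Submodule ℂ 𝓢(((Fin (n' + n')) → mixedSpace (Fp L)), ℂ)), FiniteDimensional ℂ V₀ → IsArchStable L e dV hdV hdV0 dW hdW hdW0 eW e' dV' hdV' hdV'0 χb hχbu hχbs 𝒦 V₀ →
          K2LiuArchGaussianOfRecord.holCutOfRecord L e dV hdV hdV0 dW hdW hdW0 lam hlam eW e' dV' hdV' hdV'0 χb hχbu hχbs α hα hαrat 𝒦 V₀ → ∀ x₀ : ↥(Submodule.span ℂ {x : piSchwartzBruhat (Fp L) (Fin (n' + n')) |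
              ∃ a ∈ V₀, ∃ f : FinSB (Fp L) (Fin (n' + n')), x = piSchwartzBruhatEquiv (Fp L) (Fin (n' + n')) (a ⊗ₜ[ℂ] f)}), Good V₀ x₀) →
        -- (congr) `Good` reads the datum only through its twisted Siegel–Weil generator family `g_x` (so data with EQUAL SECTIONS are interchangeable;
        -- in particular a datum whose section vanishes is as good as `0`)
        (∀ (V V' : Submodule ℂ 𝓢(((Fin (n' + n')) → mixedSpace (Fp L)), ℂ)) (x : ↥(Submodule.span ℂ {x : piSchwartzBruhat (Fp L) (Fin (n' + n')) |
              ∃ a ∈ V, ∃ f : FinSB (Fp L) (Fin (n' + n')), x = piSchwartzBruhatEquiv (Fp L) (Fin (n' + n')) (a ⊗ₜ[ℂ] f)})) (x' : ↥(Submodule.span ℂ {x : piSchwartzBruhat (Fp L) (Fin (n' + n')) |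
              ∃ a ∈ V', ∃ f : FinSB (Fp L) (Fin (n' + n')), x = piSchwartzBruhatEquiv (Fp L) (Fin (n' + n')) (a ⊗ₜ[ℂ] f)})),
          genFamily L e dV hdV hdV0 dW hdW hdW0 eW e' dV' hdV' hdV'0 χb hχbu hχbs α 𝒦 (x : piSchwartzBruhat (Fp L) (Fin (n' + n'))) =
            genFamily L e dV hdV hdV0 dW hdW hdW0 eW e' dV' hdV' hdV'0 χb hχbu hχbs α 𝒦 (x' : piSchwartzBruhat (Fp L) (Fin (n' + n'))) → Good V x → Good V' x') →
        -- (zero) (add) (smul)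
        (∀ (V : Submodule ℂ 𝓢(((Fin (n' + n')) → mixedSpace (Fp L)), ℂ)), FiniteDimensional ℂ V → IsArchStable L e dV hdV hdV0 dW hdW hdW0 eW e' dV' hdV' hdV'0 χb hχbu hχbs 𝒦 V → Good V 0) →
        (∀ (V : Submodule ℂ 𝓢(((Fin (n' + n')) → mixedSpace (Fp L)), ℂ)), FiniteDimensional ℂ V → IsArchStable L e dV hdV hdV0 dW hdW hdW0 eW e' dV' hdV' hdV'0 χb hχbu hχbs 𝒦 V →
          ∀ x y : ↥(Submodule.span ℂ {x : piSchwartzBruhat (Fp L) (Fin (n' + n')) |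
              ∃ a ∈ V, ∃ f : FinSB (Fp L) (Fin (n' + n')), x = piSchwartzBruhatEquiv (Fp L) (Fin (n' + n')) (a ⊗ₜ[ℂ] f)}), Good V x → Good V y → Good V (x + y)) →
        (∀ (V : Submodule ℂ 𝓢(((Fin (n' + n')) → mixedSpace (Fp L)), ℂ)), FiniteDimensional ℂ V → IsArchStable L e dV hdV hdV0 dW hdW hdW0 eW e' dV' hdV' hdV'0 χb hχbu hχbs 𝒦 V →
          ∀ (c : ℂ) (x : ↥(Submodule.span ℂ {x : piSchwartzBruhat (Fp L) (Fin (n' + n')) |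
              ∃ a ∈ V, ∃ f : FinSB (Fp L) (Fin (n' + n')), x = piSchwartzBruhatEquiv (Fp L) (Fin (n' + n')) (a ⊗ₜ[ℂ] f)})), Good V x → Good V (c • x)) →
        -- (deriv) stability under arch Lie derivative steps of the `s₀`-sections of the generator families
        (∀ (V : Submodule ℂ 𝓢(((Fin (n' + n')) → mixedSpace (Fp L)), ℂ)), FiniteDimensional ℂ V → IsArchStable L e dV hdV hdV0 dW hdW hdW0 eW e' dV' hdV' hdV'0 χb hχbu hχbs 𝒦 V →
          ∀ x : ↥(Submodule.span ℂ {x : piSchwartzBruhat (Fp L) (Fin (n' + n')) |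
              ∃ a ∈ V, ∃ f : FinSB (Fp L) (Fin (n' + n')), x = piSchwartzBruhatEquiv (Fp L) (Fin (n' + n')) (a ⊗ₜ[ℂ] f)}), Good V x →
          ∀ (X : Matrix (Fin (n + n)) (Fin (n + n)) (mixedSpace L)) (hX : X ∈ archSkew (Fp L) L (IsCMField.complexConj L) (n + n) (hermD L e dV hdV dW hdW)) (_hXD : DX L e dV hdV dW hdW X)
            (V' : Submodule ℂ 𝓢(((Fin (n' + n')) → mixedSpace (Fp L)), ℂ)), FiniteDimensional ℂ V' → IsArchStable L e dV hdV hdV0 dW hdW hdW0 eW e' dV' hdV' hdV'0 χb hχbu hχbs 𝒦 V' →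
          ∀ x' : ↥(Submodule.span ℂ {x : piSchwartzBruhat (Fp L) (Fin (n' + n')) |
              ∃ a ∈ V', ∃ f : FinSB (Fp L) (Fin (n' + n')), x = piSchwartzBruhatEquiv (Fp L) (Fin (n' + n')) (a ⊗ₜ[ℂ] f)}),
          HasArchDeriv L e dV hdV dW hdW hX (fun h => genFamily L e dV hdV hdV0 dW hdW hdW0 eW e' dV' hdV' hdV'0 χb hχbu hχbs α 𝒦 (x : piSchwartzBruhat (Fp L) (Fin (n' + n'))) ((((3 : ℕ) : ℂ) - (n : ℂ)) / 2) h)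
            (fun h => genFamily L e dV hdV hdV0 dW hdW hdW0 eW e' dV' hdV' hdV'0 χb hχbu hχbs α 𝒦 (x' : piSchwartzBruhat (Fp L) (Fin (n' + n'))) ((((3 : ℕ) : ℂ) - (n : ℂ)) / 2) h) → Good V' x') →
        ∀ (V : Submodule ℂ 𝓢(((Fin (n' + n')) → mixedSpace (Fp L)), ℂ)), FiniteDimensional ℂ V → IsArchStable L e dV hdV hdV0 dW hdW hdW0 eW e' dV' hdV' hdV'0 χb hχbu hχbs 𝒦 V →
          ∀ x : ↥(Submodule.span ℂ {x : piSchwartzBruhat (Fp L) (Fin (n' + n')) |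
              ∃ a ∈ V, ∃ f : FinSB (Fp L) (Fin (n' + n')), x = piSchwartzBruhatEquiv (Fp L) (Fin (n' + n')) (a ⊗ₜ[ℂ] f)}), Good V x := by
  intro Good hbase hcongr hzero hadd hsmul hderiv
  letI : LieRing (Matrix (Fin 2 ⊕ Fin 2) (Fin 2 ⊕ Fin 2) ℂ) := LieRing.ofAssociativeRing  -- `𝔲(2,2)` (as ★ K2Liu-p05)
  -- the frame of the model: `n = 2`
  have hn2 : n = 2 := eq_two_of_frame e
  -- the junction frames of record at the EXPLICIT real vector `y σ k := σ(dV′ k)` (★ K2E3-p25 `exists_junctionFrameData_embedding`, so `hyσ := rfl`) and the small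
  -- sign frames `eSp eSq` per real place (★ `exists_signFrame_two`)
  obtain ⟨eP₀, eQ₀, hE⟩ := K2LiuArchSWPivotDischarge.exists_junctionFrameData_embedding L e dV hdV hdV0 dW hdW hdW0 eW e' dV' hdV' hdV'0
  have hfr := fun σ : {v : InfinitePlace (Fp L) // v.IsReal} => exists_signFrame_two L e dV hdV hdV0 dW hdW hdW0 hn2 σ
  choose eSp eSq _ using hfr
  -- the odd unitary arch type of `χb` ([Liu2021, Remark 4.2])
  obtain ⟨t, ht, hodd⟩ := hχbs.exists_hasUnitaryArchType_odd L hχbu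
  -- the Hermite spans of the big frame are arch data for `𝒦` (★ σ15 with the bare closure letter `hK₀`)
  have hdat := fun D : ℕ => K2LiuArchPlaceSecFockDegree.isArchDatum_hermiteSpan_of_closure_kV L e dV hdV hdV0 dW hdW hdW0 eW e' dV' hdV' hdV'0 hχbu hχbs
    (isDoubledWeilRep_doubledWeilRep L e' dV hdV hdV0 (tensorFrame L dW eW dV') (tensorFrame_real L dW hdW eW dV' hdV') (tensorFrame_ne_zero L dW eW dV' hdW0 hdV'0) χb hχbu hχbs)
    ht hodd (fun σ (k : Fin 3) => embedding_of_isReal σ.2 (⟨dV' k, (IsCMField.complexConj_eq_self_iff (K := L) (dV' k)).1 (hdV' _)⟩ : Fp L))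
    (fun σ k => K2LiuArchSWPivotDischarge.embedding_dV'_ne_zero L dV' hdV' hdV'0 σ k)
    (fun σ j => K2LiuArchTensorPlaceSec.signVec_tensor L e dV hdV dW hdW eW e' dV' hdV' σ j) eP₀ eQ₀ hE 𝒦 hK₀ D
  -- ★ FILE 3 at `t := tupleVec` over the frames of record: (dom) ★ K2E3-p31, (partner) ★ (E-g-glue), (gen) below
  refine K2LiuArchSWDataFinalPassage.forall_domain_good_of_archGenerators L e dV hdV hdV0 dW hdW hdW0 eW e' dV' hdV' hdV'0 χb hχbu hχbs α 𝒦 Good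
    hcongr hzero hadd hsmul
    (tupleVec L dV hdV hdV0 dW hdW hdW0 eW e' dV' hdV' hdV'0
      (fun σ => PosIdx (fun k : Fin 3 => embedding_of_isReal σ.2 (⟨dV' k, (IsCMField.complexConj_eq_self_iff (K := L) (dV' k)).1 (hdV' _)⟩ : Fp L)))
      (fun σ => NegIdx (fun k : Fin 3 => embedding_of_isReal σ.2 (⟨dV' k, (IsCMField.complexConj_eq_self_iff (K := L) (dV' k)).1 (hdV' _)⟩ : Fp L)))
      (fun σ => (eP₀ σ).symm.trans (Equiv.sumCongr ((eSp σ).symm.prodCongr (Equiv.refl _)) ((eSq σ).symm.prodCongr (Equiv.refl _))))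
      (fun σ => (eQ₀ σ).symm.trans (Equiv.sumCongr ((eSp σ).symm.prodCongr (Equiv.refl _)) ((eSq σ).symm.prodCongr (Equiv.refl _)))))
    (K2LiuArchSWDataDomainLetters.hdom_of_hermiteData L e dV hdV hdV0 dW hdW hdW0 eW e' dV' hdV' hdV'0 χb hχbu hχbs 𝒦 _ _ _ _ hdat)
    (K2LiuArchSWDataPartnerOfIsStd.hpartner_of_isStd L e dV hdV hdV0 dW hdW hdW0 eW e' dV' hdV' hdV'0 χb hχbu hχbs α 𝒦 _ _ _ _ h𝒦 hread)
    ?_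
  -- (gen) at every tuple vector, DIRECTED, at the junction frames of record: ★ (b) §1 `good_tupleVec_of_frame_directed` (★ 2a∕2b at `Ξ := {X // X ∈ archSkew ∧ DX X}`)
  -- at J2c's frames `𝒥_σ` (`hJ` := ★ FILE 1, `J` inferred), with (piv) := ★ (A) p863733, `hR hS` := ★ blockFFT, (DX⁺)(DX⁻) := ★ p863764 §1 ∘ the PRIMED one-place letter
  -- `onePlaceLetter_directed_of_junctionFrames'` fed by `hDX` at the frames `((eSp σ)⁻¹, (eSq σ)⁻¹)`, (dom) := ★ `hdom_of_hermiteData hdat`, (vac) := ★ `vac_good_of_base` + (base)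
  -- (= ★ (b) §2's body at the single-place-ready letter; J2 (E1))
  have hn : Fintype.card (Fin 2) = n := by
    have h := Fintype.card_congr e
    simp only [Fintype.card_prod, Fintype.card_fin, mul_one] at h
    rw [Fintype.card_fin]
    exact h
  have hψD := K2LiuArchSWDataDerivLettersDirected.onePlaceLetter_directed_of_junctionFrames' L e dV hdV hdV0 dW hdW hdW0 eW e' dV' hdV' hdV'0 α (DX L e dV hdV dW hdW) hα
    (fun σ (k : Fin 3) => embedding_of_isReal σ.2 (⟨dV' k, (IsCMField.complexConj_eq_self_iff (K := L) (dV' k)).1 (hdV' _)⟩ : Fp L))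
    (fun σ k => K2LiuArchSWPivotDischarge.embedding_dV'_ne_zero L dV' hdV' hdV'0 σ k)
    (fun σ j => K2LiuArchTensorPlaceSec.signVec_tensor L e dV hdV dW hdW eW e' dV' hdV' σ j) eP₀ eQ₀ hE eSp eSq
    (fun σ Y X hX h hw => hDX σ (eSp σ).symm (eSq σ).symm Y X hX h hw)
  refine K2LiuArchSWDataInductionDirected.good_tupleVec_of_frame_directed L e dV hdV hdV0 dW hdW hdW0 eW e' dV' hdV' hdV'0 χb hχbu hχbs α 𝒦 _ _ _ _
    (fun σ => (⟨-(Fintype.card (NegIdx ((fun k : Fin 3 => embedding_of_isReal σ.2 (⟨dV' k, (IsCMField.complexConj_eq_self_iff (K := L) (dV' k)).1 (hdV' _)⟩ : Fp L)))) : ℤ), -(Fintype.card (PosIdx ((fun k : Fin 3 => embedding_of_isReal σ.2 (⟨dV' k, (IsCMField.complexConj_eq_self_iff (K := L) (dV' k)).1 (hdV' _)⟩ : Fp L)))) : ℤ), -(Fintype.card (Fin 2) : ℤ), -(Fintype.card (Fin 2) : ℤ)⟩ : VacExponents))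
    (DX L e dV hdV dW hdW) Good hcongr hzero hadd hsmul hderiv
    (K2LiuArchSWDataDomainLetters.hdom_of_hermiteData L e dV hdV hdV0 dW hdW hdW0 eW e' dV' hdV' hdV'0 χb hχbu hχbs 𝒦 _ _ _ _ hdat)
    _ (frame_tupleVec_eq_tensorPi L dV hdV hdV0 dW hdW hdW0 eW e' dV' hdV' hdV'0 _ _ _ _) (fun σ k v w f a a' ha ha' => ?_)
    (fun σ PR hPR => K2LiuFockKHInvariantsFFT.blockFFT PR hPR) (fun σ PS hPS => K2LiuFockKHInvariantsFFT.blockFFT_swap PS hPS)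
    (K2LiuArchSWDataDerivLettersDirected.hDXp_directed_of_onePlaceLetter L e dV hdV hdV0 dW hdW hdW0 eW e' dV' hdV' hdV'0 χb hχbu hχbs α 𝒦 _ _ _ _ (DX L e dV hdV dW hdW) ht hodd hψD)
    (K2LiuArchSWDataDerivLettersDirected.hDXm_directed_of_onePlaceLetter L e dV hdV hdV0 dW hdW hdW0 eW e' dV' hdV' hdV'0 χb hχbu hχbs α 𝒦 _ _ _ _ (DX L e dV hdV dW hdW) ht hodd hψD)
    (K2LiuArchSWDataInduction.vac_good_of_base L e dV hdV hdV0 dW hdW hdW0 eW e' dV' hdV' hdV'0 χb hχbu hχbs α 𝒦 _ _ _ _ Good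
      (fun V₀ => K2LiuArchGaussianOfRecord.HLrecOfRecord L dV hdV hdV0 dW hdW hdW0 eW e' dV' hdV' hdV'0 V₀) hbase hcongr
      (K2LiuArchSWDataDomainLetters.hHL_of_hermiteData L e dV hdV hdV0 dW hdW hdW0 eW e' dV' hdV' hdV'0 χb hχbu hχbs 𝒦 _ _ _ _ (hdat 0)))
  -- (piv): ★ (A) at `sB := doubledWeilRep χb`, `hyσ := rfl`, every `h ∈ U(𝔻)(𝔸)`, read through `genFamily` (★ FILE 2d ED. 1's glue)
  have key : ∀ h : HA L e dV hdV dW hdW,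
      swSectionTensor L e dV hdV dW hdW eW e' dV' hdV' hdV0 hdW0 hdV'0
          (doubledWeilRep L e' dV hdV hdV0 (tensorFrame L dW eW dV') (tensorFrame_real L dW hdW eW dV' hdV') (tensorFrame_ne_zero L dW eW dV' hdW0 hdV'0) χb hχbu hχbs)
          (piSchwartzBruhatEquiv (Fp L) (Fin (n' + n')) (a' ⊗ₜ[ℂ] f)) h =
        vacScalar (⟨-(Fintype.card (NegIdx ((fun k : Fin 3 => embedding_of_isReal σ.2 (⟨dV' k, (IsCMField.complexConj_eq_self_iff (K := L) (dV' k)).1 (hdV' _)⟩ : Fp L)))) : ℤ), -(Fintype.card (PosIdx ((fun k : Fin 3 => embedding_of_isReal σ.2 (⟨dV' k, (IsCMField.complexConj_eq_self_iff (K := L) (dV' k)).1 (hdV' _)⟩ : Fp L)))) : ℤ), -(Fintype.card (Fin 2) : ℤ), -(Fintype.card (Fin 2) : ℤ)⟩ : VacExponents)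
            (((1 : Matrix.unitaryGroup (Fin 2) ℂ × Matrix.unitaryGroup (Fin 2) ℂ), k) : DPK (Fin 2) (Fin 2) (PosIdx ((fun k : Fin 3 => embedding_of_isReal σ.2 (⟨dV' k, (IsCMField.complexConj_eq_self_iff (K := L) (dV' k)).1 (hdV' _)⟩ : Fp L)))) (NegIdx ((fun k : Fin 3 => embedding_of_isReal σ.2 (⟨dV' k, (IsCMField.complexConj_eq_self_iff (K := L) (dV' k)).1 (hdV' _)⟩ : Fp L))))) *
          swSectionTensor L e dV hdV dW hdW eW e' dV' hdV' hdV0 hdW0 hdV'0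
            (doubledWeilRep L e' dV hdV hdV0 (tensorFrame L dW eW dV') (tensorFrame_real L dW hdW eW dV' hdV') (tensorFrame_ne_zero L dW eW dV' hdW0 hdV'0) χb hχbu hχbs)
            (piSchwartzBruhatEquiv (Fp L) (Fin (n' + n')) (a ⊗ₜ[ℂ] f)) h := fun h => by
    rw [swSectionTensor_apply, swSectionTensor_apply]
    exact K2LiuArchSWPivotDischarge.swSection_junctionSlot_κOp_eq_vacScalar_mul_at_junctionFrames L e dV hdV hdV0 dW hdW hdW0 eW e' dV' hdV' hdV'0 σ hχbu hχbs
      (isDoubledWeilRep_doubledWeilRep L e' dV hdV hdV0 (tensorFrame L dW eW dV') (tensorFrame_real L dW hdW eW dV' hdV') (tensorFrame_ne_zero L dW eW dV' hdW0 hdV'0) χb hχbu hχbs)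
      ht hodd hn hn ((fun k : Fin 3 => embedding_of_isReal σ.2 (⟨dV' k, (IsCMField.complexConj_eq_self_iff (K := L) (dV' k)).1 (hdV' _)⟩ : Fp L))) (fun k => K2LiuArchSWPivotDischarge.embedding_dV'_ne_zero L dV' hdV' hdV'0 σ k) (fun _ => rfl)
      (fun j => K2LiuArchTensorPlaceSec.signVec_tensor L e dV hdV dW hdW eW e' dV' hdV' σ j) (eP₀ σ) (eQ₀ σ) (hE σ) (eSp σ) (eSq σ) f h k v w a a' ha ha'
  have hT : swSectionTensor L e dV hdV dW hdW eW e' dV' hdV' hdV0 hdW0 hdV'0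
          (doubledWeilRep L e' dV hdV hdV0 (tensorFrame L dW eW dV') (tensorFrame_real L dW hdW eW dV' hdV') (tensorFrame_ne_zero L dW eW dV' hdW0 hdV'0) χb hχbu hχbs)
          (piSchwartzBruhatEquiv (Fp L) (Fin (n' + n')) (a' ⊗ₜ[ℂ] f)) =
        vacScalar (⟨-(Fintype.card (NegIdx ((fun k : Fin 3 => embedding_of_isReal σ.2 (⟨dV' k, (IsCMField.complexConj_eq_self_iff (K := L) (dV' k)).1 (hdV' _)⟩ : Fp L)))) : ℤ), -(Fintype.card (PosIdx ((fun k : Fin 3 => embedding_of_isReal σ.2 (⟨dV' k, (IsCMField.complexConj_eq_self_iff (K := L) (dV' k)).1 (hdV' _)⟩ : Fp L)))) : ℤ), -(Fintype.card (Fin 2) : ℤ), -(Fintype.card (Fin 2) : ℤ)⟩ : VacExponents)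
            (((1 : Matrix.unitaryGroup (Fin 2) ℂ × Matrix.unitaryGroup (Fin 2) ℂ), k) : DPK (Fin 2) (Fin 2) (PosIdx ((fun k : Fin 3 => embedding_of_isReal σ.2 (⟨dV' k, (IsCMField.complexConj_eq_self_iff (K := L) (dV' k)).1 (hdV' _)⟩ : Fp L)))) (NegIdx ((fun k : Fin 3 => embedding_of_isReal σ.2 (⟨dV' k, (IsCMField.complexConj_eq_self_iff (K := L) (dV' k)).1 (hdV' _)⟩ : Fp L))))) •
          swSectionTensor L e dV hdV dW hdW eW e' dV' hdV' hdV0 hdW0 hdV'0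
            (doubledWeilRep L e' dV hdV hdV0 (tensorFrame L dW eW dV') (tensorFrame_real L dW hdW eW dV' hdV') (tensorFrame_ne_zero L dW eW dV' hdW0 hdV'0) χb hχbu hχbs)
            (piSchwartzBruhatEquiv (Fp L) (Fin (n' + n')) (a ⊗ₜ[ℂ] f)) := by
    funext h
    rw [Pi.smul_apply, smul_eq_mul]
    exact key h
  funext s h
  simp only [K2LiuFaceGLetterDefs.genFamily, Pi.smul_apply, smul_eq_mul]
  rw [hT, stdExtension_smul, Pi.smul_apply, Pi.smul_apply, smul_eq_mul]
  ring

end Summit.HodgeConjecture.HodgeConjecture.Cruxes.HLiu418.K2LiuArchWeilSectionModuleCyclic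

end
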